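import Mathlib
import HarnessLib
import Summits.Langlands.Langlands.Theses.SkinnerWilesDefectOne
import Literature.NumberTheory.GaloisRepresentations.NearlyOrdinaryDeformationRing
import Literature.NumberTheory.GaloisRepresentations.NearlyOrdinaryDeformationRingProofs
import Summits.Langlands.Langlands.Theorems.SkinnerWilesDefectOneProModularOfEisensteinSeedNicePrimeSupply
import Summits.Langlands.Langlands.Theorems.SkinnerWilesDefectOneProModularOfEisensteinSeedStableAxis

/-!
# The reducible locus of `R_𝒟` is closed; dimension-one primes with `ρ_𝒟 mod 𝔭` irreducible

Route `SkinnerWilesDefectOne`, support item stmt-Langlands-14718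
(`ProModularOfEisensteinSeed : EisensteinProModularSeed → ReducibleOrdinaryProModular`, Skinner–Wiles
steps (I)+(III) at defect one).  Step (III) measures the reducible locus
`NearlyOrdinaryDeformationRing.reducibleLocus 𝓡 ⊆ Spec R_𝒟` (the primes `𝔮` with `ρ_𝒟 mod 𝔮`
reducible over `Frac(R_𝒟/𝔮)`) against the irreducible components and then picks dimension-one primes
OFF it ([SW, §2.4, proof of Cor. 2.12]: "Choose a prime `P ⊇ Q` of `R_𝒟` having dimension one and
such that `ρ_𝒟 mod P` is also irreducible").  For this the locus must be CLOSED — in Skinner–Wiles'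
rigidified basis it is `V(I)`, `I` the ideal of the lower-left entries `c_σ` ([SW, §2.2]).  This file
proves the closedness for the tree's interface `NearlyOrdinaryDeformationRing 𝓡` of a residual datum
`𝒟` that is DISTINGUISHED at some place `v ∣ p` (`𝒟.IsDistinguishedAt v`, always available in the
route: `ModelData.Models.isDistinguishedAt`), with no appeal to Hensel's lemma:

* `exists_diagonalFrame` — a frame `D ∈ GL₂(R_𝒟)` and `g₀ ∈ Γ_F` with `D⁻¹ ρ_𝒟(g₀) D = diag(α, δ)`,
  `α − δ ∈ R_𝒟ˣ`: `g₀` is a distinguished element of `D_v`, `ρ_𝒟(g₀)` is upper triangular in the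
  universal nearly-ordinary frame `noFrame v` (part of the interface) with residually distinct
  diagonal (`residue_localRep_diag_ne`, by comparing characteristic polynomials with the residual
  frame), and an elementary shear `(1 t; 0 1)` diagonalises it;
* `reducibleLocus_eq_zeroLocus_union` — for ANY such `(D, g₀)` (by the two-by-two algebra of
  `Theorems/…ProModularOfEisensteinSeedStableAxis.lean`, `isReducible_map_comp_iff_of_diag`):
  `reducibleLocus = V({c_γ}) ∪ V({b_γ})`, `(a b; c d) = D⁻¹ ρ_𝒟 D` (a common eigenline of
  `ρ_𝒟 mod 𝔮` over the field `Frac(R/𝔮)` is an eigenline of `diag(α, δ)`, i.e. a coordinate axis);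
* `isClosed_reducibleLocus`, `isClosed_reducibleLocus'` — hence the reducible locus is Zariski closed;
* `exists_le_ringKrullDim_quotient_eq_one_notMem_reducibleLocus` (+ `…_not_mem` avoiding one more
  element, e.g. `p`, for characteristic-zero primes; `…_of_dim_le`, the Skinner–Wiles numerology
  "reducible locus of dimension `≤ n` versus components of dimension `≥ n + 1`") — the supply of
  dimension-one primes `𝔭 ⊇ C` with `ρ_𝒟 mod 𝔭` irreducible above any `C ∉ reducibleLocus` with
  `dim R_𝒟/C ≥ 2`, by the landed nice-prime supply (`Theorems/…NicePrimeSupply.lean`).  These are the primes `𝔭₁` of stub S5 and the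
  "good ⟹ nice" candidates of stub S4 of line `steinberg_hyperplane`.

References: C. M. Skinner, A. J. Wiles, *Residually reducible representations and modular forms*,
Publ. Math. IHÉS 89 (1999): §2.1 (the rigid basis: `ρ(z₁)` diagonal with distinct residual
eigenvalues), §2.2 (`R_𝒟^red = R_𝒟/I`, `I = (c_σ)`), §2.4 proof of Cor. 2.12. [SkinnerWiles1999]
-/

set_option linter.dupNamespace false -- project-wide option (lakefile weak.linter.dupNamespace); `Summit.Langlands.Langlands` is the mandated namespace

namespace Summit.Langlands.Langlands.Theorems

open scoped NumberField MatrixGroups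
open IsDedekindDomain Field Polynomial Matrix IsLocalRing
open Literature.NumberTheory.GaloisRepresentations
open Literature.NumberTheory.GaloisRepresentations.Deformation

noncomputable section

/-! ### The diagonal frame of `ρ_𝒟` at a distinguished element -/

section ReducibleLocus

variable {F : Type} [Field F] [NumberField F] {p : ℕ}
variable {𝒪 : Type} [CommRing 𝒪] {k : Type} [Field k] [Algebra 𝒪 k] {𝒟 : NearlyOrdinaryDatum F p 𝒪 k}
variable (𝓡 : NearlyOrdinaryDeformationRing.{0} 𝒟)

/-- **Residual distinctness in the universal frame.**  At a place `v ∣ p` where `𝒟` is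
distinguished by `σ ∈ Γ_{F_v}`, the upper-triangular matrix `N = (noFrame v)⁻¹ ρ_𝒟(σ) (noFrame v)`
(`localRep`) has residually distinct diagonal entries: `π(N₀₀) ≠ π(N₁₁)`.  Indeed `π(N)` and the
residual matrix in the residual frame are conjugate upper-triangular matrices over `k`, so they have
the same characteristic polynomial `(X − ψ̄ᵥ)(X − ψ̄'ᵥ)` with `ψ̄ᵥ ≠ ψ̄'ᵥ`.
[cite: SkinnerWiles1999, §2.1] -/
theorem residue_localRep_diag_ne {v : HeightOneSpectrum (𝓞 F)} (hv : (p : 𝓞 F) ∈ v.asIdeal)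
    {σ : absoluteGaloisGroup (v.adicCompletion F)}
    (hσ : ((𝒟.frame v)⁻¹ * 𝒟.residual (absGaloisRestrict F (v.adicCompletion F) σ) * 𝒟.frame v).val
        0 0 ≠
      ((𝒟.frame v)⁻¹ * 𝒟.residual (absGaloisRestrict F (v.adicCompletion F) σ) * 𝒟.frame v).val 1 1) :
    (𝓡.π : 𝓡.R →+* k) ((𝓡.localRep v σ).val 0 0) ≠ (𝓡.π : 𝓡.R →+* k) ((𝓡.localRep v σ).val 1 1) := by
  -- notation
  set π : 𝓡.R →+* k := (𝓡.π : 𝓡.R →+* k) with hπ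
  set g : absoluteGaloisGroup F := absGaloisRestrict F (v.adicCompletion F) σ with hg
  set Mbar : GL (Fin 2) k := (𝒟.frame v)⁻¹ * 𝒟.residual g * 𝒟.frame v with hMbar
  set Nbar : GL (Fin 2) k := Matrix.GeneralLinearGroup.map π (𝓡.localRep v σ) with hNbar
  set U : GL (Fin 2) k := (𝒟.frame v)⁻¹ * Matrix.GeneralLinearGroup.map π (𝓡.noFrame v) with hU
  -- `π (ρ_𝒟 g) = ρ̄ g`
  have hres : Matrix.GeneralLinearGroup.map π (𝓡.ρ g) = 𝒟.residual g := by
    have := DFunLike.congr_fun 𝓡.isLift.residual_eq g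
    simpa only [MonoidHom.comp_apply] using this
  -- `π(N) = U⁻¹ M̄ U`
  have hconjGL : Nbar = U⁻¹ * Mbar * U := by
    rw [hNbar, 𝓡.localRep_apply, map_mul, map_mul, map_inv, hres, hU, hMbar]
    group
  have hconj : Nbar.val = U.val⁻¹ * Mbar.val * U.val := by
    rw [hconjGL, Units.val_mul, Units.val_mul, Matrix.coe_units_inv]
  -- both upper triangular
  have hM10 : Mbar.val 1 0 = 0 := 𝒟.frame_spec v hv σ
  have hN10 : Nbar.val 1 0 = 0 := by
    rw [hNbar]
    change π ((𝓡.localRep v σ).val 1 0) = 0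
    rw [𝓡.localRep_lowerLeft v hv σ, map_zero]
  have hne := diag_ne_of_conj_upper U Mbar.val Nbar.val hconj hM10 hN10 hσ
  rw [hNbar] at hne
  exact hne

variable [Fact p.Prime]

omit [Fact p.Prime] in
/-- **The diagonal frame.**  If `𝒟` is distinguished at some `v ∣ p`, there are `D ∈ GL₂(R_𝒟)` and
`g₀ ∈ Γ_F` such that `D⁻¹ ρ_𝒟(g₀) D` is diagonal with UNIT difference of its diagonal entries
(Skinner–Wiles' normalisation "`ρ(z₁) = diag`" of §2.1, obtained here from the universal
nearly-ordinary frame and a shear — no Hensel lifting needed). [cite: SkinnerWiles1999, §2.1] -/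
theorem exists_diagonalFrame {v : HeightOneSpectrum (𝓞 F)} (hv : (p : 𝓞 F) ∈ v.asIdeal)
    (hdist : 𝒟.IsDistinguishedAt v) :
    ∃ (D : GL (Fin 2) 𝓡.R) (g₀ : absoluteGaloisGroup F),
      (D⁻¹ * 𝓡.ρ g₀ * D).val 0 1 = 0 ∧ (D⁻¹ * 𝓡.ρ g₀ * D).val 1 0 = 0 ∧
      IsUnit ((D⁻¹ * 𝓡.ρ g₀ * D).val 0 0 - (D⁻¹ * 𝓡.ρ g₀ * D).val 1 1) := by
  obtain ⟨σ, hσ⟩ := hdist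
  set N : GL (Fin 2) 𝓡.R := 𝓡.localRep v σ with hN
  -- `α − δ` is a unit of the local ring `R`: it is not in `ker π = 𝔪`
  have hunit : IsUnit (N.val 0 0 - N.val 1 1) := by
    by_contra h
    have hmem : N.val 0 0 - N.val 1 1 ∈ maximalIdeal 𝓡.R := h
    rw [← 𝓡.ker_π, RingHom.mem_ker, map_sub, sub_eq_zero] at hmem
    exact residue_localRep_diag_ne 𝓡 hv hσ hmem
  have hunit' : IsUnit (N.val 1 1 - N.val 0 0) := by
    rw [← neg_sub]
    exact hunit.neg
  obtain ⟨u, hu⟩ := hunit'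
  -- the shear parameter `t = β (δ − α)⁻¹`
  set t : 𝓡.R := N.val 0 1 * ↑u⁻¹ with ht
  have htN : t * (N.val 1 1 - N.val 0 0) = N.val 0 1 := by
    rw [ht, ← hu, mul_assoc, Units.inv_mul, mul_one]
  have h10 : N.val 1 0 = 0 := 𝓡.localRep_lowerLeft v hv σ
  obtain ⟨T, h00, h01, h10', h11⟩ := exists_shear_conj_eq_diag N h10 t htN
  have e : (𝓡.noFrame v * T)⁻¹ * 𝓡.ρ (absGaloisRestrict F (v.adicCompletion F) σ) *
      (𝓡.noFrame v * T) = T⁻¹ * N * T := by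
    rw [hN, 𝓡.localRep_apply]; group
  refine ⟨𝓡.noFrame v * T, absGaloisRestrict F (v.adicCompletion F) σ, ?_, ?_, ?_⟩
  · rw [e, h01]
  · rw [e, h10']
  · rw [e, h00, h11]
    exact hunit

/-! ### The reducible locus in a diagonal frame -/

omit [Fact p.Prime] in
/-- **The reducible locus in a diagonal frame** (the tree's form of Skinner–Wiles'
`Spec R_𝒟^red = V(I)`, [SW, §2.2]).  Let `D ∈ GL₂(R_𝒟)`, `g₀ ∈ Γ_F` with `D⁻¹ ρ_𝒟(g₀) D = diag(α, δ)`
and `α − δ` a unit, and write `D⁻¹ ρ_𝒟(γ) D = (a_γ b_γ; c_γ d_γ)`.  Then a prime `𝔮` lies in the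
reducible locus (i.e. `ρ_𝒟 mod 𝔮` is reducible over `K = Frac(R_𝒟/𝔮)`) iff ALL `c_γ ∈ 𝔮` or ALL
`b_γ ∈ 𝔮`: a `Γ_F`-stable line over `K` is stable under `diag(α, δ)`, `α ≠ δ` in `K`, hence is a
coordinate axis; the axis `K e₀` is stable iff every `c_γ` vanishes in `K`, the axis `K e₁` iff every
`b_γ` does.  So `reducibleLocus = V({c_γ}) ∪ V({b_γ})`. [cite: SkinnerWiles1999, §2.2] -/
theorem reducibleLocus_eq_zeroLocus_union (D : GL (Fin 2) 𝓡.R) (g₀ : absoluteGaloisGroup F)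
    (h01 : (D⁻¹ * 𝓡.ρ g₀ * D).val 0 1 = 0) (h10 : (D⁻¹ * 𝓡.ρ g₀ * D).val 1 0 = 0)
    (hunit : IsUnit ((D⁻¹ * 𝓡.ρ g₀ * D).val 0 0 - (D⁻¹ * 𝓡.ρ g₀ * D).val 1 1)) :
    𝓡.reducibleLocus =
      PrimeSpectrum.zeroLocus (Set.range fun γ => (D⁻¹ * 𝓡.ρ γ * D).val 1 0) ∪
        PrimeSpectrum.zeroLocus (Set.range fun γ => (D⁻¹ * 𝓡.ρ γ * D).val 0 1) := by
  ext 𝔮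
  -- `K = Frac(R/𝔮)`, `f : R → K` with kernel `𝔮`
  haveI : 𝔮.asIdeal.IsPrime := 𝔮.isPrime
  have hf0 : ∀ r : 𝓡.R, ((algebraMap (𝓡.R ⧸ 𝔮.asIdeal) (FractionRing (𝓡.R ⧸ 𝔮.asIdeal))).comp
      (Ideal.Quotient.mk 𝔮.asIdeal)) r = 0 ↔ r ∈ 𝔮.asIdeal := fun r => by
    rw [RingHom.comp_apply, ← Ideal.Quotient.eq_zero_iff_mem]
    exact ⟨fun h => IsFractionRing.injective (𝓡.R ⧸ 𝔮.asIdeal) (FractionRing (𝓡.R ⧸ 𝔮.asIdeal))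
      (by rw [h, map_zero]), fun h => by rw [h, map_zero]⟩
  -- the representation over `K` whose reducibility defines the locus, rewritten through `f`
  have hρK : (Matrix.GeneralLinearGroup.map (algebraMap (𝓡.R ⧸ 𝔮.asIdeal)
      (FractionRing (𝓡.R ⧸ 𝔮.asIdeal)))).comp (𝓡.modPrime 𝔮) =
      (Matrix.GeneralLinearGroup.map ((algebraMap (𝓡.R ⧸ 𝔮.asIdeal)
        (FractionRing (𝓡.R ⧸ 𝔮.asIdeal))).comp (Ideal.Quotient.mk 𝔮.asIdeal))).comp 𝓡.ρ := by
    rw [NearlyOrdinaryDeformationRing.modPrime, ← MonoidHom.comp_assoc,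
      ← Matrix.GeneralLinearGroup.map_comp]
  have hne : ((algebraMap (𝓡.R ⧸ 𝔮.asIdeal) (FractionRing (𝓡.R ⧸ 𝔮.asIdeal))).comp
      (Ideal.Quotient.mk 𝔮.asIdeal)) ((D⁻¹ * 𝓡.ρ g₀ * D).val 0 0) ≠
      ((algebraMap (𝓡.R ⧸ 𝔮.asIdeal) (FractionRing (𝓡.R ⧸ 𝔮.asIdeal))).comp
      (Ideal.Quotient.mk 𝔮.asIdeal)) ((D⁻¹ * 𝓡.ρ g₀ * D).val 1 1) := by
    intro h
    apply (hunit.map ((algebraMap (𝓡.R ⧸ 𝔮.asIdeal) (FractionRing (𝓡.R ⧸ 𝔮.asIdeal))).comp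
      (Ideal.Quotient.mk 𝔮.asIdeal))).ne_zero
    rw [map_sub, h, sub_self]
  change IsReducible _ ↔ _
  rw [hρK, isReducible_map_comp_iff_of_diag 𝓡.ρ D g₀ h01 h10 _ hne, Set.mem_union,
    PrimeSpectrum.mem_zeroLocus, PrimeSpectrum.mem_zeroLocus, Set.range_subset_iff,
    Set.range_subset_iff]
  simp only [hf0, SetLike.mem_coe]

/-! ### Closedness and the supply of dimension-one primes off the reducible locus -/

omit [Fact p.Prime] in
/-- **The reducible locus of `R_𝒟` is Zariski closed** (Skinner–Wiles: `Spec R_𝒟^red = V(I)`), for a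
residual datum distinguished at some place above `p`. [cite: SkinnerWiles1999, §2.2] -/
theorem isClosed_reducibleLocus
    (hdist : ∃ v : HeightOneSpectrum (𝓞 F), (p : 𝓞 F) ∈ v.asIdeal ∧ 𝒟.IsDistinguishedAt v) :
    IsClosed 𝓡.reducibleLocus := by
  obtain ⟨v, hv, hd⟩ := hdist
  obtain ⟨D, g₀, h01, h10, hunit⟩ := exists_diagonalFrame 𝓡 hv hd
  rw [reducibleLocus_eq_zeroLocus_union 𝓡 D g₀ h01 h10 hunit]
  exact (PrimeSpectrum.isClosed_zeroLocus _).union (PrimeSpectrum.isClosed_zeroLocus _)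

/-- The same, with the route's standing hypothesis "distinguished at EVERY `v ∣ p`" (the shape of
`ModelData.Models.isDistinguishedAt` and of `nearlyOrdinaryDeformationRing_nonempty`); a number field
has a place above `p`. [cite: SkinnerWiles1999, §2.2] -/
theorem isClosed_reducibleLocus'
    (hdist : ∀ v : HeightOneSpectrum (𝓞 F), (p : 𝓞 F) ∈ v.asIdeal → 𝒟.IsDistinguishedAt v) :
    IsClosed 𝓡.reducibleLocus := by
  obtain ⟨v, hv⟩ := NearlyOrdinaryDatum.exists_heightOneSpectrum_mem (F := F) (Fact.out : p.Prime)
  exact isClosed_reducibleLocus 𝓡 ⟨v, hv, hdist v hv⟩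

/-- **Dimension-one primes with `ρ_𝒟 mod 𝔭` irreducible** ([SW, §2.4, proof of Cor. 2.12]: "Choose a
prime `P ⊇ Q` of `R_𝒟` having dimension one and such that `ρ_𝒟 mod P` is also irreducible"): above
any prime `C` of `R_𝒟` with `dim R_𝒟/C ≥ 2` and `ρ_𝒟 mod C` irreducible (e.g. an irreducible
component not inside the reducible locus) there is a prime `𝔭 ⊇ C` of dimension one with
`ρ_𝒟 mod 𝔭` irreducible — the landed nice-prime supply applied to the closed reducible locus.
[cite: SkinnerWiles1999, §2.4 proof of Cor. 2.12] -/
theorem exists_le_ringKrullDim_quotient_eq_one_notMem_reducibleLocus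
    (hdist : ∀ v : HeightOneSpectrum (𝓞 F), (p : 𝓞 F) ∈ v.asIdeal → 𝒟.IsDistinguishedAt v)
    (C : PrimeSpectrum 𝓡.R) (hC : (2 : WithBot ℕ∞) ≤ ringKrullDim (𝓡.R ⧸ C.asIdeal))
    (hCred : C ∉ 𝓡.reducibleLocus) :
    ∃ 𝔭 : PrimeSpectrum 𝓡.R, C ≤ 𝔭 ∧ ringKrullDim (𝓡.R ⧸ 𝔭.asIdeal) = 1 ∧ 𝔭 ∉ 𝓡.reducibleLocus :=
  exists_le_ringKrullDim_quotient_eq_one_notMem C hC (isClosed_reducibleLocus' 𝓡 hdist) hCred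

/-- … and avoiding in addition one element `x ∉ C` (with `x = p`: a CHARACTERISTIC-ZERO dimension-one
prime with `ρ_𝒟 mod 𝔭` irreducible above a characteristic-zero `C`, the `𝒪′`-points `𝔭₁` of stub S5
of line `steinberg_hyperplane`; with `x = c_{σ₀} Y₁ ⋯ Y_t`: Skinner–Wiles' "such a `𝔭` always
exists", §4.3). [cite: SkinnerWiles1999, §2.4 proof of Cor. 2.12; §4.3 proof of Prop. 4.1] -/
theorem exists_le_ringKrullDim_quotient_eq_one_notMem_reducibleLocus_not_mem
    (hdist : ∀ v : HeightOneSpectrum (𝓞 F), (p : 𝓞 F) ∈ v.asIdeal → 𝒟.IsDistinguishedAt v)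
    (C : PrimeSpectrum 𝓡.R) (hC : (2 : WithBot ℕ∞) ≤ ringKrullDim (𝓡.R ⧸ C.asIdeal))
    (hCred : C ∉ 𝓡.reducibleLocus) {x : 𝓡.R} (hx : x ∉ C.asIdeal) :
    ∃ 𝔭 : PrimeSpectrum 𝓡.R, C ≤ 𝔭 ∧ ringKrullDim (𝓡.R ⧸ 𝔭.asIdeal) = 1 ∧
      𝔭 ∉ 𝓡.reducibleLocus ∧ x ∉ 𝔭.asIdeal :=
  exists_le_ringKrullDim_quotient_eq_one_notMem_not_mem C hC (isClosed_reducibleLocus' 𝓡 hdist)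
    hCred hx

/-- **Skinner–Wiles numerology for the reducible locus**: if every prime of the reducible locus has
`dim R_𝒟/𝔮 ≤ n` (`n ≥ 1`; "the reducible locus has dimension `≤ 3`") then above every prime `C` with
`dim R_𝒟/C ≥ n + 1` ("every component has dimension `≥ 4`") there is a dimension-one prime with
`ρ_𝒟 mod 𝔭` irreducible — `C ∉ reducibleLocus` being automatic.
[cite: SkinnerWiles1999, §2.4 proof of Cor. 2.12; §4.3] -/
theorem exists_le_ringKrullDim_quotient_eq_one_notMem_reducibleLocus_of_dim_le
    (hdist : ∀ v : HeightOneSpectrum (𝓞 F), (p : 𝓞 F) ∈ v.asIdeal → 𝒟.IsDistinguishedAt v)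
    {n : ℕ} (hn : 1 ≤ n) (hred : ∀ 𝔮 ∈ 𝓡.reducibleLocus, ringKrullDim (𝓡.R ⧸ 𝔮.asIdeal) ≤ n)
    (C : PrimeSpectrum 𝓡.R) (hC : ((n + 1 : ℕ) : WithBot ℕ∞) ≤ ringKrullDim (𝓡.R ⧸ C.asIdeal)) :
    ∃ 𝔭 : PrimeSpectrum 𝓡.R, C ≤ 𝔭 ∧ ringKrullDim (𝓡.R ⧸ 𝔭.asIdeal) = 1 ∧ 𝔭 ∉ 𝓡.reducibleLocus :=
  exists_le_ringKrullDim_quotient_eq_one_notMem_of_dim_le C hn hC (isClosed_reducibleLocus' 𝓡 hdist)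
    hred

end ReducibleLocus

end

end Summit.Langlands.Langlands.Theorems
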